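import Summits.KontsevichZagierPeriods.KontsevichZagierPeriods.Theorems.HyperbolicBlochOffTetraSectorKernelStubIdealSpxClassAux

/-!
# `OffTetraSectorKernel` (stmt-KontsevichZagierPeriods-10557) — line `odd-hyperbolic-ladder`
(skeleton v3), stub `stub_idealSpxClass`

Ideal simplices are standard inside the Kontsevich–Zagier calculus: in the paraboloid lift
`Ql p = (|p|², p₀, p₁, 1)` of the landed `FiveTermTransfer` (ideal point `w ↦ ℓ'(w) = (|w|², Re w, Im w, 1)`,
`∞ ↦ (1, 0, 0, 0)`; `Spx v = {p | 0 < p₂ ∧ ∀ a, 0 < det v · det (v[a := Ql p])}`), for four real-algebraic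
null future rows `n` with `det ≠ 0` the ideal tetrahedron `Spx n` carries a representation with integrand
`t⁻³`, and every such representation is KZ-equivalent to `[ρ z]`, `z` algebraic with `Im z > 0` (the
statement allows `±[ρ z]`; `+` always suffices, the mirror being a change-of-variables move).
Proof (assembly of landed lemmas; the linear algebra is in `…StubIdealSpxClassAux.lean`):
* normal form (`nf_goal`): the rows `(ℓ'∞, ℓ'0, ℓ'1, ℓ'x)` span the prism `P 0 1 x` of the five-term
  transfer (`FiveTerm.stub_detDictionary`), on which `FiveTerm.stub_prismClass` (`a = 1`, `b = 0`)
  gives a representation congruent to `[ρ x]` (`Im x > 0`) or `[ρ x̄]` (`Im x < 0`); two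
  representations with the same domain and integrand are congruent (`KZ.of_sub_of_mem_relations_of_eqOn`);
* vertex `∞` at position `0` (`goal_inf`): the similarity `z ↦ (z − w₁)/(w₂ − w₁)`
  (`IsometryMove.simil_transport` + covariance) normalises; `w₂ ≠ w₁`, `Im x ≠ 0` as
  `det v = (∏ cᵢ) · 2 Area(w₁, w₂, w₃)`;
* four finite vertices (`goal_fin`): translate `u₀` to `0` and invert (`IsometryMove.inversion_transport`;
  `J` sends `ℓ'(0) ↦ ℓ'(∞)`, `ℓ'(w) ↦ |w|² ℓ'(w⁻¹)`), then `goal_inf`;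
* `stub_idealSpxClass`: rows with `n i 3 > 0` are `n i 3 • ℓ'(uᵢ)`, `uᵢ = (n i 1 + i n i 2)/n i 3`; a row
  with `n i 3 = 0` is `n i 0 • (1,0,0,0)` and unique (`det ≠ 0`); a transposition brings it to position `0`.

References: J. L. Dupont, C.-H. Sah, J. Pure Appl. Algebra 25 (1982), §3; M. Kontsevich, D. Zagier,
*Periods* (2001), §1.2.
-/

noncomputable section

open Set
open scoped ComplexConjugate
open Literature.NumberTheory.Transcendental
open Summit.KontsevichZagierPeriods.HyperbolicBloch.IsometryMove (simil_transport inversion_transport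
  simil_image_subset inversion_image_subset inversion_inversion inversion_normSq_pos)

namespace Summit.KontsevichZagierPeriods.HyperbolicBloch.OffTetraSectorKernel

section Reduction

variable (Ql : (Fin 3 → ℝ) → Fin 4 → ℝ) (hQl : ∀ p, Ql p = ![p 0 ^ 2 + p 1 ^ 2 + p 2 ^ 2, p 0, p 1, 1])
  (Spx : (Fin 4 → Fin 4 → ℝ) → Set (Fin 3 → ℝ))
  (hSpx : ∀ v, Spx v = {p | 0 < p 2 ∧ ∀ a, 0 < (Matrix.of v).det * ((Matrix.of v).updateRow a (Ql p)).det})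
  (hcov : ∀ (g : (Fin 3 → ℝ) → (Fin 3 → ℝ)) (M : Matrix (Fin 4) (Fin 4) ℝ) (c : (Fin 3 → ℝ) → ℝ), M.det ≠ 0 →
    (∀ p : Fin 3 → ℝ, 0 < p 2 → 0 < c p ∧ 0 < g p 2 ∧ Ql (g p) = c p • M.mulVec (Ql p)) →
    (∀ p' : Fin 3 → ℝ, 0 < p' 2 → ∃ p : Fin 3 → ℝ, 0 < p 2 ∧ g p = p') →
    ∀ v : Fin 4 → Fin 4 → ℝ, g '' Spx v = Spx (fun i => M.mulVec (v i)))
  (ρ : ℂ → KZ.IntegralRep 3)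
  (hρ : ∀ z, IsAlgebraic ℚ z → 0 < z.im →
    (ρ z).domain = idealTetrahedron z ∧ EqOn (ρ z).integrand (fun p => 1 / p 2 ^ 3) (idealTetrahedron z))

include hQl hSpx hρ

/-- **Normal form.** The lifted simplex of the rows `(ℓ'∞, ℓ'0, ℓ'1, ℓ'x)` is the prism `P 0 1 x` of the
five-term transfer (`FiveTerm.stub_detDictionary`); by the prism move (`FiveTerm.stub_prismClass` with
`a = 1`, `b = 0`) it carries a representation with integrand `t⁻³`, and every such representation is
KZ-equivalent to `[ρ x]` (`Im x > 0`) or to `[ρ x̄]` (`Im x < 0`, the mirror being a move). [folklore] -/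
theorem nf_goal {x : ℂ} (hx : IsAlgebraic ℚ x) (hx0 : x.im ≠ 0) :
    (∃ R : KZ.IntegralRep 3,
        R.domain = Spx ![![1, 0, 0, 0], ![0, 0, 0, 1], ![1, 1, 0, 1], ![Complex.normSq x, x.re, x.im, 1]] ∧
        EqOn R.integrand (fun p => 1 / p 2 ^ 3) R.domain) ∧
    (∀ R : KZ.IntegralRep 3,
        R.domain = Spx ![![1, 0, 0, 0], ![0, 0, 0, 1], ![1, 1, 0, 1], ![Complex.normSq x, x.re, x.im, 1]] →
        EqOn R.integrand (fun p => 1 / p 2 ^ 3) R.domain →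
        ∃ z : ℂ, IsAlgebraic ℚ z ∧ 0 < z.im ∧ KZ.of R - KZ.of (ρ z) ∈ KZ.relations) := by
  -- the route's forms, as opaque functions pinned by their equations
  obtain ⟨L, hL⟩ : ∃ L : ℂ → ℂ → (Fin 3 → ℝ) → ℝ,
      ∀ u v p, L u v p = (v.re - u.re) * (p 1 - u.im) - (v.im - u.im) * (p 0 - u.re) :=
    ⟨_, fun _ _ _ => rfl⟩
  obtain ⟨S, hS⟩ : ∃ S : ℂ → ℂ → ℂ → (Fin 3 → ℝ) → ℝ, ∀ u v w p, S u v w p =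
      (p 0 ^ 2 + p 1 ^ 2 + p 2 ^ 2) * (u.re * (v.im - w.im) - u.im * (v.re - w.re) + (v.re * w.im - v.im * w.re)) - p 0 * (Complex.normSq u * (v.im - w.im) - u.im * (Complex.normSq v - Complex.normSq w) + (Complex.normSq v * w.im - v.im * Complex.normSq w)) + p 1 * (Complex.normSq u * (v.re - w.re) - u.re * (Complex.normSq v - Complex.normSq w) + (Complex.normSq v * w.re - v.re * Complex.normSq w)) - (Complex.normSq u * (v.re * w.im - v.im * w.re) - u.re * (Complex.normSq v * w.im - v.im * Complex.normSq w) + u.im * (Complex.normSq v * w.re - v.re * Complex.normSq w)) :=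
    ⟨_, fun _ _ _ _ => rfl⟩
  obtain ⟨P, hP⟩ : ∃ P : ℂ → ℂ → ℂ → Set (Fin 3 → ℝ), ∀ u v w, P u v w =
      {p | 0 < p 2 ∧ 0 < L u v ![w.re, w.im, 0] * L u v p ∧ 0 < L u v ![w.re, w.im, 0] * L v w p ∧
        0 < L u v ![w.re, w.im, 0] * L w u p ∧ 0 < L u v ![w.re, w.im, 0] * S u v w p} :=
    ⟨_, fun _ _ _ => rfl⟩
  obtain ⟨V5, hV5⟩ : ∃ V5 : Fin 5 → Fin 4 → ℝ, V5 = ![![1, 0, 0, 0], ![0, 0, 0, 1], ![1, 1, 0, 1],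
      ![Complex.normSq x, x.re, x.im, 1], ![Complex.normSq 0, (0 : ℂ).re, (0 : ℂ).im, 1]] := ⟨_, rfl⟩
  have hM : (Matrix.of fun a b => V5 ((4 : Fin 5).succAbove a) b) =
      Matrix.of ![![1, 0, 0, 0], ![0, 0, 0, 1], ![1, 1, 0, 1], ![Complex.normSq x, x.re, x.im, 1]] := by
    rw [hV5]
    ext a b
    fin_cases a <;> fin_cases b <;> rfl
  -- the lifted simplex is the prism `P 0 1 x`
  have hset : Spx ![![1, 0, 0, 0], ![0, 0, 0, 1], ![1, 1, 0, 1], ![Complex.normSq x, x.re, x.im, 1]] =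
      P 0 1 x := by
    ext p
    have h := (FiveTerm.stub_detDictionary L hL S hS P hP x 0 p V5 hV5 (Ql p) (hQl p)
      (fun j => (Matrix.of fun a b => V5 (j.succAbove a) b).det) (fun _ => rfl)
      (fun j a => ((Matrix.of fun a' b => V5 (j.succAbove a') b).updateRow a (Ql p)).det)
      (fun _ _ => rfl)).2.1
    rw [h, hSpx, hM]
    rfl
  -- the prism move
  obtain ⟨R, hRd, hRi, hR⟩ := FiveTerm.stub_prismClass L hL S hS P hP ρ hρ
    (fun z => if 0 < z.im then KZ.of (ρ z) else if z.im < 0 then -KZ.of (ρ (conj z)) else 0)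
    (fun _ => rfl) (fun w => if 0 < w.im then 1 else if w.im < 0 then -1 else 0) (fun _ => rfl)
    1 0 x 1 x isAlgebraic_one isAlgebraic_zero hx one_ne_zero (by ring) (by ring)
  -- its class
  have hRclass : ∃ z : ℂ, IsAlgebraic ℚ z ∧ 0 < z.im ∧ KZ.of R - KZ.of (ρ z) ∈ KZ.relations := by
    rcases lt_or_lt_iff_ne.mpr hx0 with hneg | hpos
    · refine ⟨conj x, ?_, by simpa using hneg, ?_⟩
      · simpa using hx.algHom (starRingEnd ℂ).toRatAlgHom
      · have hn : ¬0 < x.im := not_lt.mpr hneg.le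
        simp only [hn, if_false, hneg, if_true, neg_one_zsmul] at hR
        have e : KZ.of R - KZ.of (ρ (conj x)) = -KZ.of (ρ (conj x)) - -KZ.of R := by abel
        rw [e]
        exact hR
    · refine ⟨x, hx, hpos, ?_⟩
      simp only [hpos, if_true, one_zsmul] at hR
      have e : KZ.of R - KZ.of (ρ x) = -(KZ.of (ρ x) - KZ.of R) := by abel
      rw [e]
      exact neg_mem hR
  refine ⟨⟨R, hRd.trans hset.symm, hRi⟩, fun R' hR'd hR'i => ?_⟩
  obtain ⟨z, hz, hzi, hzR⟩ := hRclass
  have hcong : KZ.of R' - KZ.of R ∈ KZ.relations :=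
    KZ.of_sub_of_mem_relations_of_eqOn (by rw [hRd, hR'd, hset]) fun p hp =>
      (hR'i hp).trans (hRi (by rw [hRd, ← hset, ← hR'd]; exact hp)).symm
  refine ⟨z, hz, hzi, ?_⟩
  have e : KZ.of R' - KZ.of (ρ z) = (KZ.of R' - KZ.of R) + (KZ.of R - KZ.of (ρ z)) := by abel
  rw [e]
  exact add_mem hcong hzR

include hcov

/-- **Vertex `∞` at position `0`.** For rows `v 0 = c₀ • (1,0,0,0)`, `v i = cᵢ • ℓ'(wᵢ)` (`i = 1,2,3`,
`cᵢ > 0`, `wᵢ` algebraic) with `det v ≠ 0`, the goal holds on `Spx v`: the similarity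
`z ↦ (z - w₁)/(w₂ - w₁)` (well defined and with `Im x ≠ 0`, `x = (w₃ - w₁)/(w₂ - w₁)`, since
`det v = (∏ cᵢ) · ((w₂ - w₁) × (w₃ - w₁))`) carries `Spx v` onto the normal form. [folklore] -/
theorem goal_inf (v : Fin 4 → Fin 4 → ℝ) (c : Fin 4 → ℝ) (w : Fin 4 → ℂ)
    (hc : ∀ i, 0 < c i) (hw : ∀ i, IsAlgebraic ℚ (w i))
    (hv0 : v 0 = c 0 • ![(1 : ℝ), 0, 0, 0])
    (hv : ∀ i, i ≠ 0 → v i = c i • ![Complex.normSq (w i), (w i).re, (w i).im, 1])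
    (hdet : (Matrix.of v).det ≠ 0) :
    (∃ R : KZ.IntegralRep 3, R.domain = Spx v ∧ EqOn R.integrand (fun p => 1 / p 2 ^ 3) R.domain) ∧
    (∀ R : KZ.IntegralRep 3, R.domain = Spx v → EqOn R.integrand (fun p => 1 / p 2 ^ 3) R.domain →
      ∃ z : ℂ, IsAlgebraic ℚ z ∧ 0 < z.im ∧ KZ.of R - KZ.of (ρ z) ∈ KZ.relations) := by
  -- the determinant: `∏ cᵢ` times twice the signed area of the triangle `(w 1, w 2, w 3)`
  have hdetv : (Matrix.of v).det = c 0 * c 1 * c 2 * c 3 *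
      (((w 2).re - (w 1).re) * ((w 3).im - (w 1).im) - ((w 2).im - (w 1).im) * ((w 3).re - (w 1).re)) := by
    rw [Matrix.det_fin_four]
    simp [hv0, hv 1 (by decide), hv 2 (by decide), hv 3 (by decide)]
    ring
  have h21 : w 2 - w 1 ≠ 0 := by
    intro h
    apply hdet
    rw [hdetv, show w 2 = w 1 from sub_eq_zero.mp h]
    ring
  -- the normalising similarity `z ↦ (z - w 1) / (w 2 - w 1)`
  obtain ⟨α, hα_def⟩ : ∃ α : ℂ, α = (w 2 - w 1)⁻¹ := ⟨_, rfl⟩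
  obtain ⟨β, hβ_def⟩ : ∃ β : ℂ, β = -((w 2 - w 1)⁻¹ * w 1) := ⟨_, rfl⟩
  obtain ⟨x, hx_def⟩ : ∃ x : ℂ, x = (w 3 - w 1) / (w 2 - w 1) := ⟨_, rfl⟩
  have hα0 : α ≠ 0 := hα_def ▸ inv_ne_zero h21
  have hαalg : IsAlgebraic ℚ α := hα_def ▸ ((hw 2).sub (hw 1)).inv
  have hβalg : IsAlgebraic ℚ β := hβ_def ▸ (((hw 2).sub (hw 1)).inv.mul (hw 1)).neg
  have hxalg : IsAlgebraic ℚ x := by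
    rw [hx_def, div_eq_mul_inv]; exact ((hw 3).sub (hw 1)).mul ((hw 2).sub (hw 1)).inv
  have e1 : α * w 1 + β = 0 := by rw [hα_def, hβ_def]; ring
  have e2 : α * w 2 + β = 1 := by
    rw [hα_def, hβ_def, show (w 2 - w 1)⁻¹ * w 2 + -((w 2 - w 1)⁻¹ * w 1) = (w 2 - w 1)⁻¹ * (w 2 - w 1) by ring]
    exact inv_mul_cancel₀ h21
  have e3 : α * w 3 + β = x := by
    rw [hα_def, hβ_def, hx_def, div_eq_mul_inv]; ring
  have hxim : x.im ≠ 0 := by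
    have hN : Complex.normSq (w 2 - w 1) ≠ 0 := (Complex.normSq_pos.mpr h21).ne'
    have him : x.im = (((w 2).re - (w 1).re) * ((w 3).im - (w 1).im) -
        ((w 2).im - (w 1).im) * ((w 3).re - (w 1).re)) / Complex.normSq (w 2 - w 1) := by
      rw [hx_def, Complex.div_im]
      simp only [Complex.sub_re, Complex.sub_im]
      field_simp
    rw [him]
    refine div_ne_zero ?_ hN
    intro h
    apply hdet
    rw [hdetv, h, mul_zero]
  -- the similarity, its inverse and its Lorentz matrix
  obtain ⟨S, hS⟩ : ∃ S : (Fin 3 → ℝ) → (Fin 3 → ℝ), ∀ p, S p = ![(α * (Complex.mk (p 0) (1 * p 1)) + β).re,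
      (α * (Complex.mk (p 0) (1 * p 1)) + β).im, ‖α‖ * p 2] := ⟨_, fun _ => rfl⟩
  obtain ⟨S', hS'⟩ : ∃ S' : (Fin 3 → ℝ) → (Fin 3 → ℝ), ∀ p, S' p =
      ![(α⁻¹ * (Complex.mk (p 0) (1 * p 1)) + -(α⁻¹ * β)).re,
        (α⁻¹ * (Complex.mk (p 0) (1 * p 1)) + -(α⁻¹ * β)).im, ‖α⁻¹‖ * p 2] := ⟨_, fun _ => rfl⟩
  obtain ⟨M, hM⟩ : ∃ M : Matrix (Fin 4) (Fin 4) ℝ, M = !![α.re ^ 2 + α.im ^ 2, 2 * (α.re * β.re + α.im * β.im),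
      2 * (α.re * β.im - α.im * β.re), β.re ^ 2 + β.im ^ 2; 0, α.re, -α.im, β.re; 0, α.im, α.re, β.im; 0, 0, 0, 1] :=
    ⟨_, rfl⟩
  have hN : 0 < α.re ^ 2 + α.im ^ 2 := by
    have h := Complex.normSq_pos.mpr hα0
    rw [Complex.normSq_apply] at h
    nlinarith [h]
  -- the image rows are a rescaling of the normal form
  have hrows : (fun i => M.mulVec (v i)) = fun i => (![c 0 * (α.re ^ 2 + α.im ^ 2), c 1, c 2, c 3] : Fin 4 → ℝ) i •
      (![![1, 0, 0, 0], ![0, 0, 0, 1], ![1, 1, 0, 1], ![Complex.normSq x, x.re, x.im, 1]] : Fin 4 → Fin 4 → ℝ) i := by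
    have hr0 : M.mulVec (v 0) = (c 0 * (α.re ^ 2 + α.im ^ 2)) • ![(1 : ℝ), 0, 0, 0] := by
      rw [hv0, Matrix.mulVec_smul, simil_mulVec_inf α β M hM, smul_smul]
    have hr1 : M.mulVec (v 1) = c 1 • ![(0 : ℝ), 0, 0, 1] := by
      rw [hv 1 (by decide), Matrix.mulVec_smul, simil_mulVec_lift α β M hM, e1]
      simp
    have hr2 : M.mulVec (v 2) = c 2 • ![(1 : ℝ), 1, 0, 1] := by
      rw [hv 2 (by decide), Matrix.mulVec_smul, simil_mulVec_lift α β M hM, e2]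
      simp
    have hr3 : M.mulVec (v 3) = c 3 • ![Complex.normSq x, x.re, x.im, 1] := by
      rw [hv 3 (by decide), Matrix.mulVec_smul, simil_mulVec_lift α β M hM, e3]
    funext i
    fin_cases i <;> simp [hr0, hr1, hr2, hr3]
  have hcpos : ∀ i, 0 < (![c 0 * (α.re ^ 2 + α.im ^ 2), c 1, c 2, c 3] : Fin 4 → ℝ) i := by
    intro i
    fin_cases i
    exacts [mul_pos (hc 0) hN, hc 1, hc 2, hc 3]
  have h1 : S '' Spx v = Spx ![![1, 0, 0, 0], ![0, 0, 0, 1], ![1, 1, 0, 1], ![Complex.normSq x, x.re, x.im, 1]] := by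
    rw [simil_image Ql hQl Spx hcov β hα0 S hS M hM v, hrows, spx_smul_eq Ql Spx hSpx _ _ hcpos]
  have h2 : S' '' Spx ![![1, 0, 0, 0], ![0, 0, 0, 1], ![1, 1, 0, 1], ![Complex.normSq x, x.re, x.im, 1]] =
      Spx v := by
    rw [← h1, image_image]
    conv_rhs => rw [← image_id (Spx v)]
    exact image_congr fun p _ => (simil_inv_apply β hα0 S S' hS hS' p).1
  -- transport
  have hnf := nf_goal Ql hQl Spx hSpx ρ hρ hxalg hxim
  exact idealSpxAux_goal_transport ρ S S'
    (fun r hσ hint => (simil_transport hαalg hβalg hα0 (Or.inl rfl) S hS r hσ hint).2)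
    (fun r hσ hint => (simil_transport hαalg.inv (hαalg.inv.mul hβalg).neg (inv_ne_zero hα0) (Or.inl rfl)
      S' hS' r hσ hint).1)
    _ _ (spx_subset Ql Spx hSpx v) (spx_subset Ql Spx hSpx _) h1 h2 hnf.1 hnf.2

/-- **Four finite vertices.** For rows `v i = cᵢ • ℓ'(uᵢ)` (`cᵢ > 0`, `uᵢ` algebraic) with `det v ≠ 0`,
the goal holds on `Spx v`: the translation `z ↦ z - u₀` followed by the inversion `J` (Poincaré
extension of `w ↦ w⁻¹`, `ℓ'(w) ↦ |w|² ℓ'(w⁻¹)`, `ℓ'(0) ↦ ℓ'(∞)`) brings vertex `0` to `∞`, and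
`goal_inf` applies to the image rows. [folklore] -/
theorem goal_fin (v : Fin 4 → Fin 4 → ℝ) (c : Fin 4 → ℝ) (u : Fin 4 → ℂ)
    (hc : ∀ i, 0 < c i) (hu : ∀ i, IsAlgebraic ℚ (u i))
    (hv : ∀ i, v i = c i • ![Complex.normSq (u i), (u i).re, (u i).im, 1])
    (hdet : (Matrix.of v).det ≠ 0) :
    (∃ R : KZ.IntegralRep 3, R.domain = Spx v ∧ EqOn R.integrand (fun p => 1 / p 2 ^ 3) R.domain) ∧
    (∀ R : KZ.IntegralRep 3, R.domain = Spx v → EqOn R.integrand (fun p => 1 / p 2 ^ 3) R.domain →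
      ∃ z : ℂ, IsAlgebraic ℚ z ∧ 0 < z.im ∧ KZ.of R - KZ.of (ρ z) ∈ KZ.relations) := by
  -- the ideal points `u i`, `i ≠ 0`, differ from `u 0`
  have hu0 : ∀ i, i ≠ 0 → u i - u 0 ≠ 0 := by
    intro i hi h
    have he : u i = u 0 := sub_eq_zero.mp h
    apply hdet
    refine det_eq_zero_of_row_smul (i := 0) (j := i) (Ne.symm hi) (k := c i / c 0) ?_
    rw [hv i, hv 0, he, smul_smul, div_mul_cancel₀ _ (hc 0).ne']
  -- the translation `z ↦ z - u 0`, its inverse, its Lorentz matrix, and the inversion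
  obtain ⟨S, hS⟩ : ∃ S : (Fin 3 → ℝ) → (Fin 3 → ℝ), ∀ p, S p =
      ![((1 : ℂ) * (Complex.mk (p 0) (1 * p 1)) + -u 0).re, ((1 : ℂ) * (Complex.mk (p 0) (1 * p 1)) + -u 0).im,
        ‖(1 : ℂ)‖ * p 2] := ⟨_, fun _ => rfl⟩
  obtain ⟨S', hS'⟩ : ∃ S' : (Fin 3 → ℝ) → (Fin 3 → ℝ), ∀ p, S' p =
      ![((1 : ℂ)⁻¹ * (Complex.mk (p 0) (1 * p 1)) + -((1 : ℂ)⁻¹ * -u 0)).re,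
        ((1 : ℂ)⁻¹ * (Complex.mk (p 0) (1 * p 1)) + -((1 : ℂ)⁻¹ * -u 0)).im, ‖(1 : ℂ)⁻¹‖ * p 2] :=
    ⟨_, fun _ => rfl⟩
  obtain ⟨M, hM⟩ : ∃ M : Matrix (Fin 4) (Fin 4) ℝ, M = !![(1 : ℂ).re ^ 2 + (1 : ℂ).im ^ 2,
      2 * ((1 : ℂ).re * (-u 0).re + (1 : ℂ).im * (-u 0).im), 2 * ((1 : ℂ).re * (-u 0).im - (1 : ℂ).im * (-u 0).re),
      (-u 0).re ^ 2 + (-u 0).im ^ 2; 0, (1 : ℂ).re, -(1 : ℂ).im, (-u 0).re; 0, (1 : ℂ).im, (1 : ℂ).re, (-u 0).im;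
      0, 0, 0, 1] := ⟨_, rfl⟩
  obtain ⟨J, hJ⟩ : ∃ J : (Fin 3 → ℝ) → (Fin 3 → ℝ), ∀ p, J p = ![p 0 / (p 0 ^ 2 + p 1 ^ 2 + p 2 ^ 2),
      -p 1 / (p 0 ^ 2 + p 1 ^ 2 + p 2 ^ 2), p 2 / (p 0 ^ 2 + p 1 ^ 2 + p 2 ^ 2)] := ⟨_, fun _ => rfl⟩
  obtain ⟨v'', hv''⟩ : ∃ v'' : Fin 4 → Fin 4 → ℝ, v'' = fun i =>
      (!![0, 0, 0, 1; 0, 1, 0, 0; 0, 0, -1, 0; 1, 0, 0, 0] : Matrix (Fin 4) (Fin 4) ℝ).mulVec (M.mulVec (v i)) :=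
    ⟨_, rfl⟩
  -- the images
  have h1 : (fun p => J (S p)) '' Spx v = Spx v'' := by
    rw [(image_image J S (Spx v)).symm, simil_image Ql hQl Spx hcov (-u 0) one_ne_zero S hS M hM v,
      inversion_image Ql hQl Spx hcov J hJ, hv'']
  have h2 : (fun p => S' (J p)) '' Spx v'' = Spx v := by
    rw [← h1, image_image]
    conv_rhs => rw [← image_id (Spx v)]
    refine image_congr fun p hp => ?_
    have hp2 : 0 < S p 2 := by
      simp only [hS, Matrix.cons_val_two, Matrix.tail_cons, Matrix.head_cons]
      exact mul_pos (by simp) (spx_subset Ql Spx hSpx v hp)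
    show S' (J (J (S p))) = p
    rw [inversion_inversion J hJ (inversion_normSq_pos hp2).ne', (simil_inv_apply (-u 0) one_ne_zero S S' hS hS' p).1]
  -- the image rows: vertex `0` at `∞`, the others finite
  have hrow : ∀ i, v'' i = c i • ![1, (u i - u 0).re, -(u i - u 0).im, Complex.normSq (u i - u 0)] := by
    intro i
    rw [hv'']
    dsimp only
    rw [hv i, Matrix.mulVec_smul, Matrix.mulVec_smul, simil_mulVec_lift 1 (-u 0) M hM (u i),
      show (1 : ℂ) * u i + -u 0 = u i - u 0 by ring, inversion_mulVec_lift]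
  have hv0'' : v'' 0 = c 0 • ![(1 : ℝ), 0, 0, 0] := by
    rw [hrow 0]
    simp
  have hvi'' : ∀ i, i ≠ 0 → v'' i = (c i * Complex.normSq (u i - u 0)) •
      ![Complex.normSq (u i - u 0)⁻¹, ((u i - u 0)⁻¹).re, ((u i - u 0)⁻¹).im, 1] := by
    intro i hi
    rw [hrow i, lift_inv (hu0 i hi), smul_smul]
  have hdet'' : (Matrix.of v'').det ≠ 0 := by
    rw [hv'']
    refine det_rows_mulVec_ne_zero (det_rows_mulVec_ne_zero hdet ?_) ?_
    · rw [simil_det 1 (-u 0) M hM]; simp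
    · rw [Matrix.det_fin_four]; simp
  -- case `∞` for the image rows
  have key := goal_inf Ql hQl Spx hSpx hcov ρ hρ v''
    (fun i => if i = 0 then c 0 else c i * Complex.normSq (u i - u 0)) (fun i => (u i - u 0)⁻¹)
    (fun i => by
      split_ifs with h
      · exact hc 0
      · exact mul_pos (hc i) (Complex.normSq_pos.mpr (hu0 i h)))
    (fun i => ((hu i).sub (hu 0)).inv) (by simpa using hv0'') (fun i hi => by simpa [hi] using hvi'' i hi) hdet''
  -- transport along `J ∘ S` and back along `S' ∘ J`
  refine idealSpxAux_goal_transport ρ (fun p => J (S p)) (fun p => S' (J p)) ?_ ?_ _ _ (spx_subset Ql Spx hSpx v)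
    (spx_subset Ql Spx hSpx v'') h1 h2 key.1 key.2
  · intro r hσ hint r' hr'd hr'i
    obtain ⟨⟨r₁, hr₁d, hr₁i⟩, hm₁⟩ := simil_transport isAlgebraic_one (hu 0).neg one_ne_zero (Or.inl rfl) S hS
      r hσ hint
    have hσ₁ : r₁.domain ⊆ {p | 0 < p 2} := hr₁d ▸ simil_image_subset one_ne_zero S hS hσ
    obtain ⟨-, hm₂⟩ := inversion_transport J hJ r₁ hσ₁ hr₁i
    exact (hm₁ r₁ hr₁d hr₁i).trans (hm₂ r' (by rw [hr'd, hr₁d, image_image]) hr'i)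
  · intro r hσ hint
    obtain ⟨⟨r₂, hr₂d, hr₂i⟩, -⟩ := inversion_transport J hJ r hσ hint
    have hσ₂ : r₂.domain ⊆ {p | 0 < p 2} := hr₂d ▸ inversion_image_subset J hJ hσ
    obtain ⟨⟨r₃, hr₃d, hr₃i⟩, -⟩ := simil_transport isAlgebraic_one.inv
      (isAlgebraic_one.inv.mul (hu 0).neg).neg (inv_ne_zero one_ne_zero) (Or.inl rfl) S' hS' r₂ hσ₂ hr₂i
    exact ⟨r₃, by rw [hr₃d, hr₂d, image_image], hr₃i⟩

end Reduction

/-! ## The stub -/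

/-- STUB `stub_idealSpxClass` (ideal simplices are standard, up to sign, inside the calculus). Four real-algebraic
NULL future rows (`x² + y² = n m`, `m ≥ 0`, `n + m > 0`: lifts of points of `ℂ ∪ {∞}`) with non-zero determinant
span an ideal tetrahedron `Spx n`; it carries a representation with integrand `t⁻³` (a boundary similarity, after
an inversion when no vertex is at `∞`, puts the vertices at `∞, 0, 1, x`: a prism of the landed `FiveTermTransfer`,
`FiveTerm.stub_prismClass`, `IsometryMove.simil_transport` / `inversion_transport`), and every such representation is
KZ-equivalent to `ε • [ρ z]`, `ε = ±1`, for the cross-ratio class `z ∈ ℚ̄ ∩ ℍ⁺` of its four vertices. The covariance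
lemma is supplied as the hypothesis `hcov` (statement of `stub_spxCovariance`). Proof: rows with positive last entry
are positive multiples of lifted ideal points, a row with vanishing last entry is a multiple of the lift of `∞` and
is unique (`det ≠ 0`); after a transposition of rows (`spx_perm_eq`) the two configurations are `goal_inf` and
`goal_fin`, and `ε = 1` suffices. [cite: DupontSah1982, §3] -/
theorem stub_idealSpxClass :
    ∀ (Ql : (Fin 3 → ℝ) → Fin 4 → ℝ), (∀ p, Ql p = ![p 0 ^ 2 + p 1 ^ 2 + p 2 ^ 2, p 0, p 1, 1]) →
    ∀ (Spx : (Fin 4 → Fin 4 → ℝ) → Set (Fin 3 → ℝ)),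
      (∀ v, Spx v = {p | 0 < p 2 ∧ ∀ a, 0 < (Matrix.of v).det * ((Matrix.of v).updateRow a (Ql p)).det}) →
      (∀ (g : (Fin 3 → ℝ) → (Fin 3 → ℝ)) (M : Matrix (Fin 4) (Fin 4) ℝ) (c : (Fin 3 → ℝ) → ℝ), M.det ≠ 0 →
        (∀ p : Fin 3 → ℝ, 0 < p 2 → 0 < c p ∧ 0 < g p 2 ∧ Ql (g p) = c p • M.mulVec (Ql p)) →
        (∀ p' : Fin 3 → ℝ, 0 < p' 2 → ∃ p : Fin 3 → ℝ, 0 < p 2 ∧ g p = p') →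
        ∀ v : Fin 4 → Fin 4 → ℝ, g '' Spx v = Spx (fun i => M.mulVec (v i))) →
    ∀ (ρ : ℂ → KZ.IntegralRep 3),
      (∀ z, IsAlgebraic ℚ z → 0 < z.im →
        (ρ z).domain = idealTetrahedron z ∧ EqOn (ρ z).integrand (fun p => 1 / p 2 ^ 3) (idealTetrahedron z)) →
    ∀ (n : Fin 4 → Fin 4 → ℝ), (∀ i j, IsAlgebraic ℚ (n i j)) →
      (∀ i, n i 1 ^ 2 + n i 2 ^ 2 = n i 0 * n i 3 ∧ 0 ≤ n i 3 ∧ 0 < n i 0 + n i 3) → (Matrix.of n).det ≠ 0 →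
      (∃ r : KZ.IntegralRep 3, r.domain = Spx n ∧ EqOn r.integrand (fun p => 1 / p 2 ^ 3) r.domain) ∧
      (∀ r : KZ.IntegralRep 3, r.domain = Spx n → EqOn r.integrand (fun p => 1 / p 2 ^ 3) r.domain →
        ∃ (z : ℂ) (ε : ℤ), IsAlgebraic ℚ z ∧ 0 < z.im ∧ (ε = 1 ∨ ε = -1) ∧
          KZ.of r - ε • KZ.of (ρ z) ∈ KZ.relations) := by
  intro Ql hQl Spx hSpx hcov ρ hρ n hn hnull hdet
  -- it suffices to prove the goal with `ε = 1`
  suffices H : (∃ r : KZ.IntegralRep 3, r.domain = Spx n ∧ EqOn r.integrand (fun p => 1 / p 2 ^ 3) r.domain) ∧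
      (∀ r : KZ.IntegralRep 3, r.domain = Spx n → EqOn r.integrand (fun p => 1 / p 2 ^ 3) r.domain →
        ∃ z : ℂ, IsAlgebraic ℚ z ∧ 0 < z.im ∧ KZ.of r - KZ.of (ρ z) ∈ KZ.relations) by
    refine ⟨H.1, fun r hr hri => ?_⟩
    obtain ⟨z, hz, hzi, hzr⟩ := H.2 r hr hri
    exact ⟨z, 1, hz, hzi, Or.inl rfl, by rwa [one_zsmul]⟩
  -- the ideal points of the finite rows
  have hu : ∀ i, IsAlgebraic ℚ (⟨n i 1 / n i 3, n i 2 / n i 3⟩ : ℂ) := fun i =>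
    isAlgebraic_mk (by rw [div_eq_mul_inv]; exact (hn i 1).mul (hn i 3).inv)
      (by rw [div_eq_mul_inv]; exact (hn i 2).mul (hn i 3).inv)
  by_cases hfin : ∀ i, 0 < n i 3
  · -- four finite vertices
    exact goal_fin Ql hQl Spx hSpx hcov ρ hρ n (fun i => n i 3) (fun i => ⟨n i 1 / n i 3, n i 2 / n i 3⟩) hfin hu
      (fun i => row_eq_smul_lift (hnull i).1 (hfin i)) hdet
  · -- a vertex at `∞`: row `i₀`, unique; bring it to position `0`
    simp only [not_forall, not_lt] at hfin
    obtain ⟨i₀, hi₀⟩ := hfin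
    have h3 : n i₀ 3 = 0 := le_antisymm hi₀ (hnull i₀).2.1
    have hrow₀ : n i₀ = n i₀ 0 • ![(1 : ℝ), 0, 0, 0] := row_eq_smul_inf (hnull i₀).1 h3
    have hc₀ : 0 < n i₀ 0 := by simpa [h3] using (hnull i₀).2.2
    have hother : ∀ i, i ≠ i₀ → 0 < n i 3 := by
      intro i hi
      refine (hnull i).2.1.lt_or_eq.resolve_right fun h => hdet ?_
      have hrowi : n i = n i 0 • ![(1 : ℝ), 0, 0, 0] := row_eq_smul_inf (hnull i).1 h.symm
      obtain ⟨k, hk⟩ : ∃ k : ℝ, k = n i 0 / n i₀ 0 := ⟨_, rfl⟩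
      refine det_eq_zero_of_row_smul (i := i₀) (j := i) (Ne.symm hi) (k := k) ?_
      rw [hrowi, hrow₀, smul_smul, hk, div_mul_cancel₀ _ hc₀.ne']
    -- the transposed rows
    rw [← spx_perm_eq Ql Spx hSpx n (Equiv.swap 0 i₀)]
    have hσ : ∀ i, i ≠ 0 → (Equiv.swap 0 i₀) i ≠ i₀ := fun i hi h =>
      hi (by simpa using congrArg (Equiv.swap 0 i₀) h)
    refine goal_inf Ql hQl Spx hSpx hcov ρ hρ (fun i => n (Equiv.swap 0 i₀ i))
      (fun i => if i = 0 then n i₀ 0 else n (Equiv.swap 0 i₀ i) 3)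
      (fun i => ⟨n (Equiv.swap 0 i₀ i) 1 / n (Equiv.swap 0 i₀ i) 3, n (Equiv.swap 0 i₀ i) 2 / n (Equiv.swap 0 i₀ i) 3⟩)
      (fun i => ?_) (fun i => hu _) ?_ (fun i hi => ?_) ?_
    · split_ifs with h
      · exact hc₀
      · exact hother _ (hσ i h)
    · simpa using hrow₀
    · simpa [hi] using row_eq_smul_lift (hnull (Equiv.swap 0 i₀ i)).1 (hother _ (hσ i hi))
    · show ((Matrix.of n).submatrix (Equiv.swap 0 i₀) id).det ≠ 0
      rw [Matrix.det_permute]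
      exact mul_ne_zero (by simp [Int.cast_eq_zero, Units.ne_zero]) hdet

end Summit.KontsevichZagierPeriods.HyperbolicBloch.OffTetraSectorKernel

end
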